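import Summits.RiemannHypothesis.RiemannHypothesis.Theorems.Splittings.ZdCountWindowBlindness
import HarnessLib

/-!
# The jump principle and its sharpness (zd-neg g7 abstract models §4; nothing about `ζ` is claimed)

Cell rh-split, seat rh-split-zd-neg g7 (brief sha16 f79c5f09d8bcb036), card `run/shared/lean/pub/rh-split/cards/SPLIT-zd-neg.md`
GEN-7 ADDENDUM (N54); §4 of `HOME/rh-split-zd-neg/SketchG7.lean` sha16 d551080ba97c8cef byte-verbatim, zero definitions, on top of
`ZdCountWindowBlindness.lean` (§§1–3); referee rh-split-ref g3 REPLAY PASS + labels 2026-08-27T05:33:05Z, lead rh-split-lead g3 RULING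
#24 (x); filed by rh-split-typer-2 g4, same namespace `…Theorems.Splittings.ZdCountWindowBlindness`.

* `onLineAbove_of_ordInjectiveAbove` — the abstract JUMP PRINCIPLE: FE-symmetry + all ordinate fibres of size `1` above `H` ⟹ RH-shape
  above `H` (the card's N13);
* `merged` has all fibres of size `≤ 2` (`not_onLine_of_fibreLeTwo`) and `triple k` has a CRITICAL point at every ordinate (and odd fibres
  `1, 3`: `ncard_fibre_triple`), both FE-symmetric and not RH-shape: the thresholds «jump `= 1`» (N13/N14) and «`|S| < 1`» (N7, `c ≤ 1`)
  are exact, and «a sign change of `Z` at every zero ordinate» (the SIGNS half of a Turing-type verification, without the COUNT half) is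
  not a splitting partner (`not_onLine_of_criticalAtEveryOrdinate`).

HONEST LABEL: «SPLITTING SEARCH over kernel-typed RH-EQUIVALENCES; a splitting A ∧ B ⟹ RH is CONDITIONAL bookkeeping unless A and B are
both proved; nothing here bears on the truth of RH.»  LABELS (referee g3): N54 sharpness — abstract jump principle RH-FREE kernel; fibre
≤ 2 / critical-at-every-ordinate / odd parity NOT splitting partners; class (zd, neg) UNCHANGED.
-/

set_option linter.dupNamespace false

noncomputable section

open Complex ComplexConjugate Filter Set

namespace Summit.RiemannHypothesis.RiemannHypothesis.Theorems.Splittings.ZdCountWindowBlindness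

/-! ## §4 The jump principle and its sharpness -/

/-- **Abstract jump principle (the card's N13).** FE-symmetry and unit ordinate fibres above `H`
force RH-shape above `H`. -/
theorem onLineAbove_of_ordInjectiveAbove {z : Config} {H : ℝ} (hfe : FESymm z)
    (hinj : OrdInjectiveAbove z H) : OnLineAbove z H := by
  intro n hn
  obtain ⟨m, hm⟩ := hfe n
  have him : (z n).im = (z m).im := by rw [hm]; simp
  have hnm : n = m := hinj n m hn him
  subst hnm
  have hre := congrArg Complex.re hm
  simp at hre
  linarith

/-- **Sharpness I.** Fibres of size `≤ 2` (jumps `≤ 2`, `|S| < 3/2`-type tails) do NOT force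
RH-shape, even with FE-symmetry and FIN-shape: the merged configuration. -/
theorem not_onLine_of_fibreLeTwo (k : ℕ) :
    ¬ ∀ z : Config, FESymm z → OnLineUpTo z (k + 1) → FibreLeTwoAbove z (k + 1) →
      OnLineAbove z (k + 1) :=
  fun h ↦ not_onLineAbove_merged k
    (h _ (feSymm_merged k) (onLineUpTo_merged k) (fibreLeTwo_merged k _))

/-! ### The coincidence configuration `triple k` -/

/-- `triple k` is FE-symmetric. -/
theorem feSymm_triple (k : ℕ) : FESymm (triple k) := by
  intro n
  by_cases h1 : n = k
  · refine ⟨k, ?_⟩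
    subst h1
    simp only [triple, if_true, one_sub_conj_mk]
    norm_num
  · by_cases h2 : n = k + 1
    · refine ⟨k + 2, ?_⟩
      subst h2
      have h3 : k + 2 ≠ k := by omega
      have h4 : k + 2 ≠ k + 1 := by omega
      simp only [triple, h3, h4, if_true, if_false, Nat.succ_ne_self, one_sub_conj_mk]
      norm_num
    · by_cases h3 : n = k + 2
      · refine ⟨k + 1, ?_⟩
        subst h3
        have h4 : k + 1 ≠ k := by omega
        have h5 : k + 1 ≠ k + 2 := by omega
        have h6 : k + 2 ≠ k + 1 := by omega
        have h7 : k + 2 ≠ k := by omega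
        simp only [triple, h4, h5, h6, h7, if_true, if_false, one_sub_conj_mk]
        norm_num
      · refine ⟨n, ?_⟩
        simp only [triple, h1, h2, h3, if_false, one_sub_conj_mk]
        norm_num

/-- `triple k` is RH-shaped up to height `k + 1`. -/
theorem onLineUpTo_triple (k : ℕ) : OnLineUpTo (triple k) (k + 1) := by
  intro n hn
  rw [triple_im] at hn
  rw [triple_re]
  by_cases h : n = k ∨ n = k + 1 ∨ n = k + 2
  · rw [if_pos h] at hn; linarith
  · have h2 : ¬ n = k + 1 := fun e ↦ h (Or.inr (Or.inl e))
    have h3 : ¬ n = k + 2 := fun e ↦ h (Or.inr (Or.inr e))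
    simp [h2, h3]

/-- `triple k` is NOT RH-shaped above height `k + 1`. -/
theorem not_onLineAbove_triple (k : ℕ) : ¬ OnLineAbove (triple k) (k + 1) := by
  intro h
  have h1 := h (k + 1) (by rw [triple_im]; simp; linarith)
  rw [triple_re] at h1
  simp at h1
  norm_num at h1

/-- Every ordinate of `triple k` carries a critical point. -/
theorem criticalAtEveryOrdinate_triple (k : ℕ) (H : ℝ) :
    CriticalAtEveryOrdinateAbove (triple k) H := by
  intro n _
  by_cases h : n = k ∨ n = k + 1 ∨ n = k + 2
  · refine ⟨k, ?_, ?_⟩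
    · rw [triple_im, triple_im, if_pos (Or.inl rfl), if_pos h]
    · rw [triple_re]
      simp
  · refine ⟨n, rfl, ?_⟩
    rw [triple_re]
    have h2 : ¬ n = k + 1 := fun e ↦ h (Or.inr (Or.inl e))
    have h3 : ¬ n = k + 2 := fun e ↦ h (Or.inr (Or.inr e))
    simp [h2, h3]

/-- **Sharpness II (the coincidence loophole).** "Every zero ordinate above `H` is the ordinate of a
critical zero" — what sign changes of `Z` certify — does NOT force RH-shape, even with FE-symmetry
and FIN-shape: the SIGNS half of a verification is no splitting partner without the COUNT half. -/
theorem not_onLine_of_criticalAtEveryOrdinate (k : ℕ) :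
    ¬ ∀ z : Config, FESymm z → OnLineUpTo z (k + 1) → CriticalAtEveryOrdinateAbove z (k + 1) →
      OnLineAbove z (k + 1) :=
  fun h ↦ not_onLineAbove_triple k
    (h _ (feSymm_triple k) (onLineUpTo_triple k) (criticalAtEveryOrdinate_triple k _))

/-- The fibre of the coincidence height has THREE elements (an odd jump of `N`). -/
theorem fibre_triple_half (k : ℕ) :
    {n | (triple k n).im = (k : ℝ) + 3 / 2} = {k, k + 1, k + 2} := by
  ext n
  simp only [Set.mem_setOf_eq, Set.mem_insert_iff, Set.mem_singleton_iff, triple_im]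
  by_cases h : n = k ∨ n = k + 1 ∨ n = k + 2
  · rw [if_pos h]; simp [h]
  · rw [if_neg h]
    constructor
    · intro e; exact absurd e.symm (half_ne_succ k n)
    · intro e; exact absurd e h

/-- The ordinate fibre of `triple k` at height `k + 3/2` has exactly three elements. -/
theorem ncard_fibre_triple_half (k : ℕ) :
    ({n | (triple k n).im = (k : ℝ) + 3 / 2} : Set ℕ).ncard = 3 := by
  rw [fibre_triple_half, Set.ncard_eq_three]
  exact ⟨k, k + 1, k + 2, by omega, by omega, by omega, rfl⟩

/-- Every other non-empty fibre of `triple k` is a singleton. -/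
theorem fibre_triple_comb (k n : ℕ) (hn : ¬ (n = k ∨ n = k + 1 ∨ n = k + 2)) :
    {m | (triple k m).im = (triple k n).im} = {n} := by
  ext m
  simp only [Set.mem_setOf_eq, Set.mem_singleton_iff, triple_im, if_neg hn]
  by_cases hm : m = k ∨ m = k + 1 ∨ m = k + 2
  · rw [if_pos hm]
    constructor
    · intro e; exact absurd e (half_ne_succ k n)
    · intro e; subst e; exact absurd hm hn
  · rw [if_neg hm]
    constructor
    · intro e; exact_mod_cast (add_right_cancel e : (m : ℝ) = n)
    · intro e; subst e; rfl

/-- **Sharpness III (parity).** All jumps of the counting function of `triple k` are ODD (`1` or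
`3`), yet RH-shape fails: "odd jumps above `H`" is no splitting partner either. -/
theorem ncard_fibre_triple (k n : ℕ) :
    ({m | (triple k m).im = (triple k n).im} : Set ℕ).ncard = 1 ∨
      ({m | (triple k m).im = (triple k n).im} : Set ℕ).ncard = 3 := by
  by_cases hn : n = k ∨ n = k + 1 ∨ n = k + 2
  · right
    have : (triple k n).im = (k : ℝ) + 3 / 2 := by rw [triple_im, if_pos hn]
    rw [this]
    exact ncard_fibre_triple_half k
  · left
    rw [fibre_triple_comb k n hn, Set.ncard_singleton]

end Summit.RiemannHypothesis.RiemannHypothesis.Theorems.Splittings.ZdCountWindowBlindness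

end
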